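import Summits.ResolutionOfSingularities.ResolutionOfSingularities.Theorems.FrobeniusLadderFInjectiveMacaulayficationFiClauseAdicTransfer
import Literature.AlgebraicGeometry.Resolution.BlowupAlgebraFlatBaseChange
import Literature.AlgebraicGeometry.Resolution.BlowupChartTransition
import Mathlib.RingTheory.RingHom.FaithfullyFlat
import Mathlib.RingTheory.Localization.AtPrime.Basic
import HarnessLib

/-!
# Chart-level 𝔪-adic transfer of the stalk clause: `A[(c)/c_j]_𝔔 → B[(φc)/φc_j]_𝔔'` —
# step (H2) of §T2 / 5i `pointFixable_adicTransfer` (crux stmt-ResolutionOfSingularities-15315, chain w45a)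

[OURS · L1 W4.5a · res-D-pv-019 AS res-L1-w45a-stub-7] Support file (`--supports stmt-ResolutionOfSingularities-15315 --as helper`)
for the crux `FrobeniusLadder.FInjectiveMacaulayfication`; NOT a statement of any manuscript; AI-written, weaker than expert review.

SETTING. `A → B` a flat local homomorphism of Noetherian local rings with `𝔪_A B = 𝔪_B` and `A → B/𝔪_B^m` surjective for all
`m` (𝔪-ADICALLY DENSE: completion, henselisation, étale neighbourhood with the same residue field); `I ⊆ A` an ideal, `J = I·B`,
`a ∈ A`; `R = A[I/a]`, `R' = B[J/a]` the affine blowup algebras and `ψ : R → R'` the base-change map (`blowupAlgebraMap`;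
`R' = B ⊗_A R` by `Literature…BlowupAlgebraFlatBaseChange`, p515956).

RESULTS (all PROVED, no named facts, any `p : ℕ`):
* `faithfullyFlat_blowupAlgebraMap` — `ψ` is faithfully flat when `B` is faithfully flat over `A` (base change);
* `comap_comap_eq_maximalIdeal` / `exists_prime_over` — the primes of `R'` over `𝔪_B` and the primes of `R` over `𝔪_A`
  correspond under `𝔔' ↦ ψ⁻¹𝔔'` (surjectivity from faithful flatness); `map_comap_eq_of_over` — `𝔔' = (ψ⁻¹𝔔')·R'` for
  `𝔔'` over `𝔪_B` (density);
* RING-GENERIC CORE (`R → R'` any flat map of Noetherian rings, `𝔔' = ψ(𝔔)R'`, `ψ(R)` dense for the `𝔔'`-adic topology):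
  `map_maximalIdeal_localRingHom` (`𝔪_𝔔 R'_𝔔' = 𝔪_𝔔'`), `exists_sub_localRingHom_mem` (density passes to `R_𝔔 → R'_𝔔'`:
  numerators AND denominators are approximated), `fiClause_atPrime_iff_of_flat_of_dense` (§T2a
  `FiClauseAdicTransfer.fiClause_adicTransfer`, p513273, applied to `R_𝔔 → R'_𝔔'`);
* `fiClause_atPrime_iff` — **for `𝔔'` over `𝔪_B` and `𝔔 = ψ⁻¹𝔔'`, the Cohen–Macaulay + Frobenius-closed clause holds at
  `A[I/a]_𝔔` iff it holds at `B[J/a]_𝔔'`.**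
This is the chart-by-chart content of PFixTowerSig r2 (b235fde4a11e66a6) §T2 `stub_pointFixable_adicTransfer` (5i).
-/

-- single-problem summit: the doubled namespace component is forced
set_option linter.dupNamespace false

noncomputable section

namespace Summit.ResolutionOfSingularities.ResolutionOfSingularities.Theorems.FInjectiveMacaulayfication.PointFixableChartTransfer

open IsLocalRing Literature.AlgebraicGeometry.Resolution
open scoped TensorProduct

variable {A B : Type} [CommRing A] [CommRing B] [Algebra A B] (I : Ideal A) (J : Ideal B) (a : A)
  (hIJ : I.map (algebraMap A B) ≤ J)

/-! ## Faithful flatness of `ψ` and the correspondence of primes over the maximal ideals -/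

/-- **`ψ : A[I/a] → B[J/a]` is faithfully flat** for `B` faithfully flat over `A` and `J = I·B` (base change: the square is a
pushout by `BlowupAlgebraFlatBaseChange.exists_baseChange_linearEquiv`, and Mathlib
`RingHom.FaithfullyFlat.isStableUnderBaseChange`). [folklore] -/
theorem faithfullyFlat_blowupAlgebraMap (hJI : J ≤ I.map (algebraMap A B)) [Module.FaithfullyFlat A B] :
    (blowupAlgebraMap (algebraMap A B) I J a hIJ).FaithfullyFlat := by
  letI := (blowupAlgebraMap (algebraMap A B) I J a hIJ).toAlgebra
  haveI : IsScalarTower A (blowupAlgebra I a) (blowupAlgebra J (algebraMap A B a)) :=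
    IsScalarTower.of_algebraMap_eq fun x => by
      rw [RingHom.algebraMap_toAlgebra, blowupAlgebraMap_algebraMap, ← IsScalarTower.algebraMap_apply]
  haveI : Algebra.IsPushout A B (blowupAlgebra I a) (blowupAlgebra J (algebraMap A B a)) := by
    obtain ⟨e, he⟩ := BlowupAlgebraFlatBaseChange.exists_baseChange_linearEquiv I J a hIJ hJI
    refine ⟨IsBaseChange.of_equiv e fun r => ?_⟩
    rw [he, one_smul]
    rfl
  exact RingHom.FaithfullyFlat.isStableUnderBaseChange A B (blowupAlgebra I a) (blowupAlgebra J (algebraMap A B a))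
    (RingHom.faithfullyFlat_algebraMap_iff.mpr inferInstance)

/-- `ψ ∘ (A → A[I/a]) = (B → B[J/a]) ∘ φ` on ideals: `(K·A[I/a])·B[J/a] = (K·B)·B[J/a]`. [folklore] -/
theorem map_map_algebraMap (K : Ideal A) :
    (K.map (algebraMap A (blowupAlgebra I a))).map (blowupAlgebraMap (algebraMap A B) I J a hIJ) =
      (K.map (algebraMap A B)).map (algebraMap B (blowupAlgebra J (algebraMap A B a))) := by
  rw [Ideal.map_map, Ideal.map_map, blowupAlgebraMap_comp_algebraMap]

/-- Dually on contractions: `(𝔔' ∩ B) ∩ A = (ψ⁻¹𝔔') ∩ A`. [folklore] -/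
theorem comap_comap_algebraMap (𝔔' : Ideal (blowupAlgebra J (algebraMap A B a))) :
    (𝔔'.comap (blowupAlgebraMap (algebraMap A B) I J a hIJ)).comap (algebraMap A (blowupAlgebra I a)) =
      (𝔔'.comap (algebraMap B (blowupAlgebra J (algebraMap A B a)))).comap (algebraMap A B) := by
  rw [Ideal.comap_comap, Ideal.comap_comap, blowupAlgebraMap_comp_algebraMap]

/-! ## Two lemmas on `Localization.localRingHom` (pure localization algebra) -/

/-- If `𝔔' = ψ(𝔔)·R'` for `𝔔 = ψ⁻¹𝔔'`, then the induced local map `R_𝔔 → R'_𝔔'` satisfies `𝔪_𝔔 · R'_𝔔' = 𝔪_𝔔'`. [folklore] -/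
theorem map_maximalIdeal_localRingHom {R R' : Type*} [CommRing R] [CommRing R'] (ψ : R →+* R')
    (𝔔' : Ideal R') [𝔔'.IsPrime] (𝔔 : Ideal R) [𝔔.IsPrime] (h𝔔 : 𝔔 = 𝔔'.comap ψ) (hmap : 𝔔.map ψ = 𝔔') :
    (maximalIdeal (Localization.AtPrime 𝔔)).map (Localization.localRingHom 𝔔 𝔔' ψ h𝔔) =
      maximalIdeal (Localization.AtPrime 𝔔') := by
  have hcomp : (Localization.localRingHom 𝔔 𝔔' ψ h𝔔).comp (algebraMap R (Localization.AtPrime 𝔔)) =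
      (algebraMap R' (Localization.AtPrime 𝔔')).comp ψ :=
    RingHom.ext fun r => by simp only [RingHom.comp_apply, Localization.localRingHom_to_map]
  calc (maximalIdeal (Localization.AtPrime 𝔔)).map (Localization.localRingHom 𝔔 𝔔' ψ h𝔔)
      = (𝔔.map (algebraMap R (Localization.AtPrime 𝔔))).map (Localization.localRingHom 𝔔 𝔔' ψ h𝔔) := by
        rw [Localization.AtPrime.map_eq_maximalIdeal]
    _ = 𝔔.map ((Localization.localRingHom 𝔔 𝔔' ψ h𝔔).comp (algebraMap R (Localization.AtPrime 𝔔))) := Ideal.map_map _ _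
    _ = 𝔔.map ((algebraMap R' (Localization.AtPrime 𝔔')).comp ψ) := by rw [hcomp]
    _ = (𝔔.map ψ).map (algebraMap R' (Localization.AtPrime 𝔔')) := (Ideal.map_map _ _).symm
    _ = maximalIdeal (Localization.AtPrime 𝔔') := by rw [hmap, Localization.AtPrime.map_eq_maximalIdeal]

/-- **Density passes to the local rings.** If every element of `R'` is `ψ(r) + k` with `k` in an ideal `K ⊆ 𝔔'`, then
every element of `R'_𝔔'` is `θ(w) + k'` with `w ∈ R_𝔔` (`𝔔 = ψ⁻¹𝔔'`, `θ` the induced local map) and `k' ∈ K·R'_𝔔'`: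
for `z = x/s` with `x = ψ(r) + k`, `s = ψ(t) + k'` one has `t ∉ 𝔔` and `x/s − ψ(r)/ψ(t) = (k·ψ(t) − ψ(r)·k')/(s·ψ(t))`.
[folklore] -/
theorem exists_sub_localRingHom_mem {R R' : Type*} [CommRing R] [CommRing R'] (ψ : R →+* R')
    (𝔔' : Ideal R') [𝔔'.IsPrime] (𝔔 : Ideal R) [𝔔.IsPrime] (h𝔔 : 𝔔 = 𝔔'.comap ψ)
    (K : Ideal R') (hK : K ≤ 𝔔') (hdense : ∀ x : R', ∃ r : R, x - ψ r ∈ K) (z : Localization.AtPrime 𝔔') :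
    ∃ w : Localization.AtPrime 𝔔,
      z - Localization.localRingHom 𝔔 𝔔' ψ h𝔔 w ∈ K.map (algebraMap R' (Localization.AtPrime 𝔔')) := by
  obtain ⟨x, s, hxs⟩ : ∃ (x : R') (s : 𝔔'.primeCompl), IsLocalization.mk' (Localization.AtPrime 𝔔') x s = z :=
    ⟨_, _, IsLocalization.mk'_sec _ z⟩
  subst hxs
  obtain ⟨r, hr⟩ := hdense x
  obtain ⟨t, ht⟩ := hdense s.1
  -- `t ∉ 𝔔`, since `s = ψ(t) + (s - ψ t)` with `s - ψ t ∈ K ⊆ 𝔔'`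
  have htQ : t ∈ 𝔔.primeCompl := by
    intro htmem
    apply s.2
    have h1 : ψ t ∈ 𝔔' := by
      rw [h𝔔] at htmem
      exact htmem
    have h3 : s.1 = ψ t + (s.1 - ψ t) := by ring
    rw [h3]
    exact add_mem h1 (hK ht)
  have hψt : ψ t ∈ 𝔔'.primeCompl := fun h => htQ (by rw [h𝔔]; exact h)
  refine ⟨IsLocalization.mk' (Localization.AtPrime 𝔔) r ⟨t, htQ⟩, ?_⟩
  -- the units `1/s`, `1/ψ(t)` of `R'_𝔔'`
  have hsu : algebraMap R' (Localization.AtPrime 𝔔') s.1 * IsLocalization.mk' (Localization.AtPrime 𝔔') (1 : R') s = 1 := by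
    rw [mul_comm, IsLocalization.mk'_spec, map_one]
  have htu' : algebraMap R' (Localization.AtPrime 𝔔') (ψ t) *
      IsLocalization.mk' (Localization.AtPrime 𝔔') (1 : R') ⟨ψ t, hψt⟩ = 1 := by
    rw [mul_comm]
    exact (IsLocalization.mk'_spec (Localization.AtPrime 𝔔') (1 : R') ⟨ψ t, hψt⟩).trans (map_one _)
  have hθw : Localization.localRingHom 𝔔 𝔔' ψ h𝔔 (IsLocalization.mk' (Localization.AtPrime 𝔔) r ⟨t, htQ⟩) =
      algebraMap R' (Localization.AtPrime 𝔔') (ψ r) * IsLocalization.mk' (Localization.AtPrime 𝔔') (1 : R') ⟨ψ t, hψt⟩ := by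
    rw [Localization.localRingHom_mk', IsLocalization.mk'_eq_mul_mk'_one]
  have hz : IsLocalization.mk' (Localization.AtPrime 𝔔') x s =
      algebraMap R' (Localization.AtPrime 𝔔') x * IsLocalization.mk' (Localization.AtPrime 𝔔') (1 : R') s :=
    IsLocalization.mk'_eq_mul_mk'_one _ _
  have key : IsLocalization.mk' (Localization.AtPrime 𝔔') x s -
      Localization.localRingHom 𝔔 𝔔' ψ h𝔔 (IsLocalization.mk' (Localization.AtPrime 𝔔) r ⟨t, htQ⟩) =
      IsLocalization.mk' (Localization.AtPrime 𝔔') (1 : R') s * IsLocalization.mk' (Localization.AtPrime 𝔔') (1 : R') ⟨ψ t, hψt⟩ *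
        algebraMap R' (Localization.AtPrime 𝔔') ((x - ψ r) * ψ t - ψ r * (s.1 - ψ t)) := by
    rw [hθw, hz]
    calc algebraMap R' (Localization.AtPrime 𝔔') x * IsLocalization.mk' (Localization.AtPrime 𝔔') 1 s -
          algebraMap R' (Localization.AtPrime 𝔔') (ψ r) * IsLocalization.mk' (Localization.AtPrime 𝔔') 1 ⟨ψ t, hψt⟩
        = algebraMap R' (Localization.AtPrime 𝔔') x * IsLocalization.mk' (Localization.AtPrime 𝔔') 1 s *
              (algebraMap R' (Localization.AtPrime 𝔔') (ψ t) * IsLocalization.mk' (Localization.AtPrime 𝔔') (1 : R') ⟨ψ t, hψt⟩) -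
            algebraMap R' (Localization.AtPrime 𝔔') (ψ r) * IsLocalization.mk' (Localization.AtPrime 𝔔') 1 ⟨ψ t, hψt⟩ *
              (algebraMap R' (Localization.AtPrime 𝔔') s.1 * IsLocalization.mk' (Localization.AtPrime 𝔔') (1 : R') s) := by
          rw [hsu, htu', mul_one, mul_one]
      _ = IsLocalization.mk' (Localization.AtPrime 𝔔') (1 : R') s * IsLocalization.mk' (Localization.AtPrime 𝔔') (1 : R') ⟨ψ t, hψt⟩ *
            algebraMap R' (Localization.AtPrime 𝔔') ((x - ψ r) * ψ t - ψ r * (s.1 - ψ t)) := by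
          simp only [map_sub, map_mul]; ring
  rw [key]
  exact Ideal.mul_mem_left _ _ (Ideal.mem_map_of_mem _ (sub_mem (Ideal.mul_mem_right _ _ hr) (Ideal.mul_mem_left _ _ ht)))

/-- **Adic transfer of the stalk clause along a flat local map with dense image** (ring-generic form): `ψ : R → R'` a flat
map of Noetherian rings, `𝔔'` a prime of `R'` with `𝔔' = ψ(𝔔)·R'` for `𝔔 = ψ⁻¹𝔔'`, and `ψ(R)` dense in `R'` for the `𝔔'`-adic
topology (`R' = ψ(R) + 𝔔'^m` for all `m`). Then the induced local map `R_𝔔 → R'_𝔔'` is flat (Mathlib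
`RingHom.Flat.localRingHom`), local, with `𝔪_𝔔·R'_𝔔' = 𝔪_𝔔'` (`map_maximalIdeal_localRingHom`) and dense
(`exists_sub_localRingHom_mem`), so §T2a `FiClauseAdicTransfer.fiClause_adicTransfer` gives: the Cohen–Macaulay +
Frobenius-closed clause holds at `R_𝔔` iff it holds at `R'_𝔔'`. [folklore] -/
theorem fiClause_atPrime_iff_of_flat_of_dense (p : ℕ) {R R' : Type} [CommRing R] [CommRing R'] [IsNoetherianRing R]
    [IsNoetherianRing R'] (ψ : R →+* R') (hflat : ψ.Flat) (𝔔' : Ideal R') [𝔔'.IsPrime] (𝔔 : Ideal R) [𝔔.IsPrime]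
    (h𝔔 : 𝔔 = 𝔔'.comap ψ) (hmap : 𝔔.map ψ = 𝔔') (hdense : ∀ (m : ℕ) (x : R'), ∃ r : R, x - ψ r ∈ 𝔔' ^ m) :
    (∀ d : ℕ, ringKrullDim (Localization.AtPrime 𝔔) = d → ∀ s : Fin d → Localization.AtPrime 𝔔,
        (Ideal.span (Set.range s)).radical.IsMaximal →
          RingTheory.Sequence.IsWeaklyRegular (Localization.AtPrime 𝔔) (List.ofFn s) ∧
          ∀ y : Localization.AtPrime 𝔔, (∃ e : ℕ, y ^ p ^ e ∈ Ideal.span ((fun z : Localization.AtPrime 𝔔 => z ^ p ^ e) ''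
            (Ideal.span (Set.range s) : Set (Localization.AtPrime 𝔔)))) → y ∈ Ideal.span (Set.range s)) ↔
    (∀ d : ℕ, ringKrullDim (Localization.AtPrime 𝔔') = d → ∀ s : Fin d → Localization.AtPrime 𝔔',
        (Ideal.span (Set.range s)).radical.IsMaximal →
          RingTheory.Sequence.IsWeaklyRegular (Localization.AtPrime 𝔔') (List.ofFn s) ∧
          ∀ y : Localization.AtPrime 𝔔', (∃ e : ℕ, y ^ p ^ e ∈ Ideal.span ((fun z : Localization.AtPrime 𝔔' => z ^ p ^ e) ''
            (Ideal.span (Set.range s) : Set (Localization.AtPrime 𝔔')))) → y ∈ Ideal.span (Set.range s)) := by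
  haveI : IsNoetherianRing (Localization.AtPrime 𝔔) := IsLocalization.isNoetherianRing 𝔔.primeCompl _ inferInstance
  haveI : IsNoetherianRing (Localization.AtPrime 𝔔') := IsLocalization.isNoetherianRing 𝔔'.primeCompl _ inferInstance
  -- the local map `θ = localRingHom : R_𝔔 → R'_𝔔'` as an algebra: local and flat
  letI := (Localization.localRingHom 𝔔 𝔔' ψ h𝔔).toAlgebra
  have halg : algebraMap (Localization.AtPrime 𝔔) (Localization.AtPrime 𝔔') = Localization.localRingHom 𝔔 𝔔' ψ h𝔔 := rfl
  haveI : IsLocalHom (algebraMap (Localization.AtPrime 𝔔) (Localization.AtPrime 𝔔')) :=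
    Localization.isLocalHom_localRingHom 𝔔 𝔔' ψ h𝔔
  haveI : Module.Flat (Localization.AtPrime 𝔔) (Localization.AtPrime 𝔔') := hflat.localRingHom 𝔔' 𝔔 h𝔔
  -- (c) `𝔪_𝔔 · R'_𝔔' = 𝔪_𝔔'`
  have hmax : (maximalIdeal (Localization.AtPrime 𝔔)).map (algebraMap (Localization.AtPrime 𝔔) (Localization.AtPrime 𝔔')) =
      maximalIdeal (Localization.AtPrime 𝔔') := by
    rw [halg]
    exact map_maximalIdeal_localRingHom ψ 𝔔' 𝔔 h𝔔 hmap
  -- (d) density of `θ` modulo `𝔪_𝔔'^m`: approximate modulo `K = 𝔔'^(m+1)`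
  have hsurjθ : ∀ m : ℕ, Function.Surjective (fun w : Localization.AtPrime 𝔔 =>
      Ideal.Quotient.mk (maximalIdeal (Localization.AtPrime 𝔔') ^ m)
        (algebraMap (Localization.AtPrime 𝔔) (Localization.AtPrime 𝔔') w)) := by
    intro m z
    obtain ⟨z, rfl⟩ := Ideal.Quotient.mk_surjective z
    obtain ⟨w, hw⟩ := exists_sub_localRingHom_mem ψ 𝔔' 𝔔 h𝔔 (𝔔' ^ (m + 1)) (Ideal.pow_le_self m.succ_ne_zero)
      (hdense (m + 1)) z
    refine ⟨w, ?_⟩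
    beta_reduce
    rw [Ideal.Quotient.eq, halg,
      show Localization.localRingHom 𝔔 𝔔' ψ h𝔔 w - z = -(z - Localization.localRingHom 𝔔 𝔔' ψ h𝔔 w) by ring,
      ← Localization.AtPrime.map_eq_maximalIdeal, ← Ideal.map_pow]
    exact Submodule.neg_mem _ (Ideal.map_mono (Ideal.pow_le_pow_right (Nat.le_succ m)) hw)
  exact FiClauseAdicTransfer.fiClause_adicTransfer p (Localization.AtPrime 𝔔) (Localization.AtPrime 𝔔') hmax hsurjθ

section Local

variable [IsLocalRing A] [IsLocalRing B]
  (h𝔪 : (maximalIdeal A).map (algebraMap A B) = maximalIdeal B)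

include h𝔪 in
/-- `𝔪_B ∩ A = 𝔪_A` when `𝔪_A·B = 𝔪_B`. [folklore] -/
theorem comap_maximalIdeal_eq : (maximalIdeal B).comap (algebraMap A B) = maximalIdeal A := by
  refine ((IsLocalRing.maximalIdeal.isMaximal A).eq_of_le ?_ ?_).symm
  · exact Ideal.IsPrime.ne_top inferInstance
  · rw [← h𝔪]
    exact Ideal.le_comap_map

include h𝔪 in
/-- **A prime `𝔔'` of `B[J/a]` over `𝔪_B` contracts to a prime `ψ⁻¹𝔔'` of `A[I/a]` over `𝔪_A`.** [folklore] -/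
theorem comap_comap_eq_maximalIdeal (𝔔' : Ideal (blowupAlgebra J (algebraMap A B a)))
    (h𝔔' : 𝔔'.comap (algebraMap B (blowupAlgebra J (algebraMap A B a))) = maximalIdeal B) :
    (𝔔'.comap (blowupAlgebraMap (algebraMap A B) I J a hIJ)).comap (algebraMap A (blowupAlgebra I a)) =
      maximalIdeal A := by
  rw [comap_comap_algebraMap, h𝔔', comap_maximalIdeal_eq h𝔪]

include h𝔪 in
/-- `𝔪_B · B[J/a] ⊆ ψ(𝔔)·B[J/a]` for a prime `𝔔` of `A[I/a]` over `𝔪_A`. [folklore] -/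
theorem map_maximalIdeal_le_map (𝔔 : Ideal (blowupAlgebra I a))
    (h𝔔 : 𝔔.comap (algebraMap A (blowupAlgebra I a)) = maximalIdeal A) :
    (maximalIdeal B).map (algebraMap B (blowupAlgebra J (algebraMap A B a))) ≤
      𝔔.map (blowupAlgebraMap (algebraMap A B) I J a hIJ) := by
  rw [← h𝔪, ← map_map_algebraMap]
  exact Ideal.map_mono (Ideal.map_le_iff_le_comap.mpr h𝔔.ge)

include h𝔪 in
/-- **Density: `𝔔' = (ψ⁻¹𝔔')·B[J/a]`** for a prime `𝔔'` of `B[J/a]` over `𝔪_B`, when `B` is flat over `A`, `J = I·B` and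
`B = φ(A) + 𝔪_B` (every `x ∈ 𝔔'` is `ψ(r) + w` with `w ∈ 𝔪_B·B[J/a] ⊆ 𝔔'`, so `r ∈ ψ⁻¹𝔔'`). [folklore] -/
theorem map_comap_eq_of_over [Module.Flat A B] (hJI : J ≤ I.map (algebraMap A B))
    (hdense : ∀ b : B, ∃ a₀ : A, b - algebraMap A B a₀ ∈ maximalIdeal B)
    (𝔔' : Ideal (blowupAlgebra J (algebraMap A B a)))
    (h𝔔' : 𝔔'.comap (algebraMap B (blowupAlgebra J (algebraMap A B a))) = maximalIdeal B) :
    (𝔔'.comap (blowupAlgebraMap (algebraMap A B) I J a hIJ)).map (blowupAlgebraMap (algebraMap A B) I J a hIJ) = 𝔔' := by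
  refine le_antisymm Ideal.map_comap_le fun x hx => ?_
  obtain ⟨r, hr⟩ := BlowupAlgebraFlatBaseChange.exists_sub_mem_map_of_forall I J a hIJ hJI (maximalIdeal B) hdense x
  have hle : (maximalIdeal B).map (algebraMap B (blowupAlgebra J (algebraMap A B a))) ≤
      (𝔔'.comap (blowupAlgebraMap (algebraMap A B) I J a hIJ)).map (blowupAlgebraMap (algebraMap A B) I J a hIJ) :=
    map_maximalIdeal_le_map I J a hIJ h𝔪 _ (comap_comap_eq_maximalIdeal I J a hIJ h𝔪 𝔔' h𝔔')
  have h1 : x - blowupAlgebraMap (algebraMap A B) I J a hIJ r ∈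
      (𝔔'.comap (blowupAlgebraMap (algebraMap A B) I J a hIJ)).map (blowupAlgebraMap (algebraMap A B) I J a hIJ) := hle hr
  have h2 : blowupAlgebraMap (algebraMap A B) I J a hIJ r ∈ 𝔔' := by
    have : blowupAlgebraMap (algebraMap A B) I J a hIJ r = x - (x - blowupAlgebraMap (algebraMap A B) I J a hIJ r) := by ring
    rw [this]
    exact sub_mem hx (Ideal.map_comap_le h1)
  have h3 : blowupAlgebraMap (algebraMap A B) I J a hIJ r ∈
      (𝔔'.comap (blowupAlgebraMap (algebraMap A B) I J a hIJ)).map (blowupAlgebraMap (algebraMap A B) I J a hIJ) :=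
    Ideal.mem_map_of_mem _ (Ideal.mem_comap.mpr h2)
  have : x = blowupAlgebraMap (algebraMap A B) I J a hIJ r + (x - blowupAlgebraMap (algebraMap A B) I J a hIJ r) := by ring
  rw [this]
  exact add_mem h3 h1

include h𝔪 in
/-- **Every prime `𝔔` of `A[I/a]` over `𝔪_A` is `ψ⁻¹𝔔'` for a prime `𝔔'` of `B[J/a]` over `𝔪_B`** (`B` faithfully flat over
`A`, `J = I·B`, `𝔪_A B = 𝔪_B`): lying over along the faithfully flat `ψ`. [folklore] -/
theorem exists_prime_over [Module.FaithfullyFlat A B] (hJI : J ≤ I.map (algebraMap A B)) (𝔔 : Ideal (blowupAlgebra I a)) [𝔔.IsPrime]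
    (h𝔔 : 𝔔.comap (algebraMap A (blowupAlgebra I a)) = maximalIdeal A) :
    ∃ 𝔔' : Ideal (blowupAlgebra J (algebraMap A B a)), 𝔔'.IsPrime ∧
      𝔔'.comap (blowupAlgebraMap (algebraMap A B) I J a hIJ) = 𝔔 ∧
      𝔔'.comap (algebraMap B (blowupAlgebra J (algebraMap A B a))) = maximalIdeal B := by
  have hff := faithfullyFlat_blowupAlgebraMap I J a hIJ hJI
  obtain ⟨-, hsurj⟩ := RingHom.FaithfullyFlat.iff_flat_and_comap_surjective.mp hff
  obtain ⟨⟨𝔔', h𝔔'⟩, h⟩ := hsurj ⟨𝔔, inferInstance⟩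
  have hc : 𝔔'.comap (blowupAlgebraMap (algebraMap A B) I J a hIJ) = 𝔔 := congrArg PrimeSpectrum.asIdeal h
  refine ⟨𝔔', h𝔔', hc, ?_⟩
  refine ((IsLocalRing.maximalIdeal.isMaximal B).eq_of_le ?_ ?_).symm
  · exact Ideal.IsPrime.ne_top inferInstance
  · rw [← Ideal.map_le_iff_le_comap]
    refine (map_maximalIdeal_le_map I J a hIJ h𝔪 𝔔 h𝔔).trans ?_
    rw [← hc]
    exact Ideal.map_comap_le

/-! ## The local map `R_𝔔 → R'_𝔔'` and the transfer of the clause -/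

include h𝔪 in
/-- **Chart-level 𝔪-adic transfer.** `A → B` flat local, Noetherian, `𝔪_A B = 𝔪_B`, `A → B/𝔪_B^m` onto for all `m`;
`J = I·B`; `𝔔'` a prime of `B[J/a]` over `𝔪_B`, `𝔔 = ψ⁻¹𝔔'`. Then the Cohen–Macaulay + Frobenius-closed clause (inline, as in
the crux) holds at `A[I/a]_𝔔` iff it holds at `B[J/a]_𝔔'`: the induced local homomorphism `A[I/a]_𝔔 → B[J/a]_𝔔'`
(`Localization.localRingHom`) is flat (`flat_blowupAlgebraMap` + Mathlib `RingHom.Flat.localRingHom`), satisfies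
`𝔪_𝔔·B[J/a]_𝔔' = 𝔪_𝔔'` (`𝔔' = ψ(𝔔)·B[J/a]`) and is dense (`x/s` with `x = ψ(r) + y`, `s = ψ(t) + y'`, `y, y' ∈ 𝔪_B^m B[J/a]`,
is `ψ(r)/ψ(t)` modulo `𝔪_𝔔'^m`), so §T2a `FiClauseAdicTransfer.fiClause_adicTransfer` applies. [folklore] -/
theorem fiClause_atPrime_iff (p : ℕ) [IsNoetherianRing A] [IsNoetherianRing B] [IsLocalHom (algebraMap A B)]
    [Module.Flat A B] (hJI : J ≤ I.map (algebraMap A B))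
    (hsurj : ∀ m : ℕ, Function.Surjective (fun x : A => Ideal.Quotient.mk (maximalIdeal B ^ m) (algebraMap A B x)))
    (𝔔' : Ideal (blowupAlgebra J (algebraMap A B a))) [𝔔'.IsPrime]
    (h𝔔' : 𝔔'.comap (algebraMap B (blowupAlgebra J (algebraMap A B a))) = maximalIdeal B)
    (𝔔 : Ideal (blowupAlgebra I a)) [𝔔.IsPrime] (h𝔔 : 𝔔 = 𝔔'.comap (blowupAlgebraMap (algebraMap A B) I J a hIJ)) :
    (∀ d : ℕ, ringKrullDim (Localization.AtPrime 𝔔) = d → ∀ s : Fin d → Localization.AtPrime 𝔔,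
        (Ideal.span (Set.range s)).radical.IsMaximal →
          RingTheory.Sequence.IsWeaklyRegular (Localization.AtPrime 𝔔) (List.ofFn s) ∧
          ∀ y : Localization.AtPrime 𝔔, (∃ e : ℕ, y ^ p ^ e ∈ Ideal.span ((fun z : Localization.AtPrime 𝔔 => z ^ p ^ e) ''
            (Ideal.span (Set.range s) : Set (Localization.AtPrime 𝔔)))) → y ∈ Ideal.span (Set.range s)) ↔
    (∀ d : ℕ, ringKrullDim (Localization.AtPrime 𝔔') = d → ∀ s : Fin d → Localization.AtPrime 𝔔',
        (Ideal.span (Set.range s)).radical.IsMaximal →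
          RingTheory.Sequence.IsWeaklyRegular (Localization.AtPrime 𝔔') (List.ofFn s) ∧
          ∀ y : Localization.AtPrime 𝔔', (∃ e : ℕ, y ^ p ^ e ∈ Ideal.span ((fun z : Localization.AtPrime 𝔔' => z ^ p ^ e) ''
            (Ideal.span (Set.range s) : Set (Localization.AtPrime 𝔔')))) → y ∈ Ideal.span (Set.range s)) := by
  haveI : IsNoetherianRing (blowupAlgebra I a) := isNoetherianRing_blowupAlgebra_of_isNoetherianRing I a
  haveI : IsNoetherianRing (blowupAlgebra J (algebraMap A B a)) :=
    isNoetherianRing_blowupAlgebra_of_isNoetherianRing J (algebraMap A B a)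
  have hdense1 : ∀ b : B, ∃ a₀ : A, b - algebraMap A B a₀ ∈ maximalIdeal B := by
    intro b
    obtain ⟨a₀, ha₀⟩ := hsurj 1 (Ideal.Quotient.mk _ b)
    exact ⟨a₀, by simpa only [pow_one] using Ideal.Quotient.eq.mp ha₀.symm⟩
  have hmap : 𝔔.map (blowupAlgebraMap (algebraMap A B) I J a hIJ) = 𝔔' := by
    rw [h𝔔]
    exact map_comap_eq_of_over I J a hIJ h𝔪 hJI hdense1 𝔔' h𝔔'
  have hdense : ∀ (m : ℕ) (x : blowupAlgebra J (algebraMap A B a)), ∃ r : blowupAlgebra I a,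
      x - blowupAlgebraMap (algebraMap A B) I J a hIJ r ∈ 𝔔' ^ m := by
    intro m x
    obtain ⟨r, hr⟩ := BlowupAlgebraFlatBaseChange.exists_sub_mem_map_of_forall I J a hIJ hJI (maximalIdeal B ^ m)
      (fun b => by
        obtain ⟨a₀, ha₀⟩ := hsurj m (Ideal.Quotient.mk _ b)
        exact ⟨a₀, Ideal.Quotient.eq.mp ha₀.symm⟩) x
    refine ⟨r, ?_⟩
    have hle : (maximalIdeal B ^ m).map (algebraMap B (blowupAlgebra J (algebraMap A B a))) ≤ 𝔔' ^ m := by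
      rw [Ideal.map_pow]
      exact Ideal.pow_right_mono (Ideal.map_le_iff_le_comap.mpr h𝔔'.ge) m
    exact hle hr
  exact fiClause_atPrime_iff_of_flat_of_dense p (blowupAlgebraMap (algebraMap A B) I J a hIJ)
    (BlowupAlgebraFlatBaseChange.flat_blowupAlgebraMap I J a hIJ hJI) 𝔔' 𝔔 h𝔔 hmap hdense

end Local

end Summit.ResolutionOfSingularities.ResolutionOfSingularities.Theorems.FInjectiveMacaulayfication.PointFixableChartTransfer

end
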